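import Literature.Geometry.Riemannian.HamiltonPCOPinchingFour
import Mathlib.Analysis.Convex.SpecificFunctions.Pow
import HarnessLib

/-!
# Hamilton 1986, Thm. 7.1, inequality (5): `a₃ ≤ a₁ + L a₁^{1-θ}`, `c₃ ≤ c₁ + L c₁^{1-θ}` are preserved — proved
(topic `Geometry/Riemannian`)

Fifth and last group of inequalities of the pinching set of **Hamilton 1986, Thm. 7.1**
(J. Differential Geom. 24, p. 170; the ODE layer of
`Literature.Geometry.Riemannian.hamilton_positiveCurvatureOperator_classification_four`, see
`HamiltonPCOPinchingOne/Two/Three/Four.lean`). Hamilton, pp. 173–174: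

* **Cor. 7.7.** "For some constant `k` and some `θ > 0` we have `b₃² ≤ k a₁^{1-θ} a₃` on the
  previous set" (from (4), `a₁ ≤ a₃ ≤ Ha₁` and `c₁ ≤ c = a`);
* **Lemma 7.8.** "Let `f = (a₁ + L a₁^{1-θ})/a₃`. If `θ > 0` is made small enough, and if `L` is
  then made large enough, we will have `df/dt ≥ 0` for `f ≤ 1`. Consequently the set `f ≥ 1` is
  preserved": `d/dt log (a₁ + L a₁^{1-θ}) ≥ (a₁ + 2a₃) - 3θHL a₁^{1-θ}` (from
  `d/dt log a₁ ≥ a₁ + 2a₃`), `d/dt log a₃ ≤ a₃ + 2a₁ + k a₁^{1-θ}`, so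
  `d/dt log f ≥ (a₃ - a₁) - (3θHL + k) a₁^{1-θ} ≥ 0` if `f ≤ 1` (then `a₃ - a₁ ≥ L a₁^{1-θ}`),
  `3θH ≤ ½` and `L ≥ 2k`. "A similar argument works for the inequality in `c`. This completes the
  proof of Theorem 7.1."

PROVED here at the ODE level (`HamiltonODE.IsInvariantRel`), in closed variational form
(`LargestLESmallestAddPow A L θ`: `uᵀAu ≤ wᵀAw + L (wᵀAw)^{1-θ}` for all unit `u`, `w`; the
right-hand side is increasing in `wᵀAw ≥ 0`, so this is `a₃ ≤ a₁ + L a₁^{1-θ}`):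

* `hamilton1986_pinchingFive_ode` — for `0 < m, K, ε`, `θ(2 + ε) = 2ε` (the exponent of Cor. 7.7
  in the variational bookkeeping, which uses `c₁ ≤ c/3 ≤ a₃` instead of `c₁ ≤ 3a₃`), `θ ≤ 1`, `6Hθ ≤ 1`
  ("`3θH ≤ ½`") and `2K^{1-θ/2} ≤ L` ("`L ≥ 2k`"), both inequalities (5) are forward invariant
  relative to `{A, C symmetric} ∩ {tr A = tr C} ∩ {M ≥ m} ∩ {(2)} ∩ {(4)}`; whence the invariant
  closed convex `B ↦ -B`-symmetric set `pcoPinchingFive = Z₄ ∩ {(5)}` — **Hamilton's pinching set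
  `Z` of Thm. 7.1** in the tree's language (its use in 5.2 — `|M̊| ≤ C |M|^{1-δ}` on `Z` — is not in
  this file).

Proof: barrier lemma for `𝒢 = wᵀMw + L (wᵀMw)^{1-θ} - uᵀMu` over `unitSet²`; at a minimiser
with `𝒢 ≤ 0` the vector `w` minimises and `u` maximises the Rayleigh quotient (`t ↦ t + Lt^{1-θ}`
is increasing), `u ⊥ w`, and in the eigenbasis `(w, n, u)` the scalar Lemma 7.8 (`lemma78`, with
Cor. 7.7 as `lemma77`) gives `𝒢' ≥ (R/m) 𝒢`.

## References

* R. S. Hamilton, *Four-manifolds with positive curvature operator*, J. Differential Geom. 24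
  (1986) 153–179: §7, Thm. 7.1 (p. 170), Lemma 7.2 (p. 171), Cor. 7.7 (p. 173), Lemma 7.8
  (pp. 173–174). [Hamilton1986]
-/

noncomputable section

open Set Real Filter
open scoped Matrix BigOperators Topology

namespace Literature.Geometry.Riemannian

namespace HamiltonODE

/-! ### The set (5) and the barrier functional -/

/-- **`a₃ ≤ a₁ + L a₁^{1-θ}`** (Hamilton 1986, Thm. 7.1, inequality (5)) for a `3 × 3` block,
variationally and in closed form: `uᵀAu ≤ wᵀAw + L (wᵀAw)^{1-θ}` for all unit `u`, `w`.
[cite: Hamilton1986, §7, Thm. 7.1 (5) (p. 170)] -/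
def LargestLESmallestAddPow (A : Matrix (Fin 3) (Fin 3) ℝ) (L θ : ℝ) : Prop :=
  ∀ u w : Fin 3 → ℝ, u ⬝ᵥ u = 1 → w ⬝ᵥ w = 1 →
    u ⬝ᵥ (A *ᵥ u) ≤ w ⬝ᵥ (A *ᵥ w) + L * (w ⬝ᵥ (A *ᵥ w)) ^ (1 - θ)

/-- The barrier functional `𝒢 = wᵀAw + L (wᵀAw)^{1-θ} - uᵀAu` on `unitSet × unitSet`, `q = (u, w)`.
[folklore] -/
def pcoFiveG (L θ : ℝ) (A : Matrix (Fin 3) (Fin 3) ℝ) (q : UU) : ℝ :=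
  q.2 ⬝ᵥ (A *ᵥ q.2) + L * (q.2 ⬝ᵥ (A *ᵥ q.2)) ^ (1 - θ) - q.1 ⬝ᵥ (A *ᵥ q.1)

/-- Its derivative along a matrix curve with velocity `A'` (where `wᵀAw ≠ 0`). [folklore] -/
def pcoFiveG' (L θ : ℝ) (A A' : Matrix (Fin 3) (Fin 3) ℝ) (q : UU) : ℝ :=
  q.2 ⬝ᵥ (A' *ᵥ q.2) + L * (q.2 ⬝ᵥ (A' *ᵥ q.2) * (1 - θ) * (q.2 ⬝ᵥ (A *ᵥ q.2)) ^ (1 - θ - 1)) -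
    q.1 ⬝ᵥ (A' *ᵥ q.1)

/-- (5) iff `𝒢 ≥ 0` on `unitSet × unitSet`. [folklore] -/
theorem largestLESmallestAddPow_iff (L θ : ℝ) (A : Matrix (Fin 3) (Fin 3) ℝ) :
    LargestLESmallestAddPow A L θ ↔ ∀ q ∈ (unitSet ×ˢ unitSet : Set UU), 0 ≤ pcoFiveG L θ A q := by
  constructor
  · rintro h ⟨u, w⟩ ⟨hu, hw⟩
    have := h u w hu hw
    simp only [pcoFiveG]; linarith
  · intro h u w hu hw
    have := h (u, w) ⟨hu, hw⟩
    simp only [pcoFiveG] at this; linarith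

/-! ### Calculus and continuity -/

/-- Derivative of `𝒢` along a matrix curve with entrywise derivative, where `wᵀAw ≠ 0`. [folklore] -/
theorem hasDerivAt_pcoFiveG (L θ : ℝ) {A : ℝ → Matrix (Fin 3) (Fin 3) ℝ} {A' : Matrix (Fin 3) (Fin 3) ℝ}
    {s : ℝ} (hA : ∀ k l, _root_.HasDerivAt (fun t ↦ A t k l) (A' k l) s) (q : UU)
    (hX : q.2 ⬝ᵥ (A s *ᵥ q.2) ≠ 0) :
    _root_.HasDerivAt (fun t ↦ pcoFiveG L θ (A t) q) (pcoFiveG' L θ (A s) A' q) s := by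
  have hX' := hasDerivAt_quadForm hA q.2 q.2
  have hY' := hasDerivAt_quadForm hA q.1 q.1
  have hP := hX'.rpow_const (p := 1 - θ) (Or.inl hX)
  have h := (hX'.add (hP.const_mul L)).sub hY'
  refine (h.congr_of_eventuallyEq (Filter.Eventually.of_forall fun t ↦ ?_)).congr_deriv ?_
  · simp only [pcoFiveG, Pi.add_apply, Pi.sub_apply]
  · simp only [pcoFiveG']

section Continuity

variable (L θ : ℝ)

/-- `(A, q) ↦ 𝒢` is continuous for `θ ≤ 1`. [folklore] -/
theorem continuous_pcoFiveG (hθ : θ ≤ 1) : Continuous fun z : Matrix (Fin 3) (Fin 3) ℝ × UU ↦ pcoFiveG L θ z.1 z.2 := by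
  unfold pcoFiveG
  have h := continuous_quadForm
  have hX : Continuous fun z : Matrix (Fin 3) (Fin 3) ℝ × UU ↦ z.2.2 ⬝ᵥ (z.1 *ᵥ z.2.2) :=
    h.comp (continuous_fst.prodMk ((continuous_snd.comp continuous_snd).prodMk (continuous_snd.comp continuous_snd)))
  have hY : Continuous fun z : Matrix (Fin 3) (Fin 3) ℝ × UU ↦ z.2.1 ⬝ᵥ (z.1 *ᵥ z.2.1) :=
    h.comp (continuous_fst.prodMk ((continuous_fst.comp continuous_snd).prodMk (continuous_fst.comp continuous_snd)))
  exact (hX.add (continuous_const.mul (hX.rpow_const fun _ ↦ Or.inr (by linarith)))).sub hY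

/-- `(A, A', q) ↦ 𝒢'` is continuous on `{wᵀAw ≠ 0}`. [folklore] -/
theorem continuousOn_pcoFiveG' :
    ContinuousOn (fun z : Matrix (Fin 3) (Fin 3) ℝ × Matrix (Fin 3) (Fin 3) ℝ × UU ↦ pcoFiveG' L θ z.1 z.2.1 z.2.2)
      {z | z.2.2.2 ⬝ᵥ (z.1 *ᵥ z.2.2.2) ≠ 0} := by
  unfold pcoFiveG'
  have h := continuous_quadForm
  have hq : Continuous fun z : Matrix (Fin 3) (Fin 3) ℝ × Matrix (Fin 3) (Fin 3) ℝ × UU ↦ z.2.2 :=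
    continuous_snd.comp continuous_snd
  have hw := continuous_snd.comp hq
  have hu := continuous_fst.comp hq
  have hX : Continuous fun z : Matrix (Fin 3) (Fin 3) ℝ × Matrix (Fin 3) (Fin 3) ℝ × UU ↦
      z.2.2.2 ⬝ᵥ (z.1 *ᵥ z.2.2.2) := h.comp (continuous_fst.prodMk (hw.prodMk hw))
  have hX' : Continuous fun z : Matrix (Fin 3) (Fin 3) ℝ × Matrix (Fin 3) (Fin 3) ℝ × UU ↦
      z.2.2.2 ⬝ᵥ (z.2.1 *ᵥ z.2.2.2) := h.comp ((continuous_fst.comp continuous_snd).prodMk (hw.prodMk hw))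
  have hY' : Continuous fun z : Matrix (Fin 3) (Fin 3) ℝ × Matrix (Fin 3) (Fin 3) ℝ × UU ↦
      z.2.2.1 ⬝ᵥ (z.2.1 *ᵥ z.2.2.1) := h.comp ((continuous_fst.comp continuous_snd).prodMk (hu.prodMk hu))
  have hP : ContinuousOn (fun z : Matrix (Fin 3) (Fin 3) ℝ × Matrix (Fin 3) (Fin 3) ℝ × UU ↦
      (z.2.2.2 ⬝ᵥ (z.1 *ᵥ z.2.2.2)) ^ (1 - θ - 1)) {z | z.2.2.2 ⬝ᵥ (z.1 *ᵥ z.2.2.2) ≠ 0} :=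
    hX.continuousOn.rpow_const fun z hz ↦ Or.inl hz
  exact (hX'.continuousOn.add (continuousOn_const.mul (((hX'.mul continuous_const).continuousOn.mul hP)))).sub
    hY'.continuousOn

attribute [local irreducible] pcoFiveG in
/-- Joint continuity of `𝒢` along a continuous matrix curve. [folklore] -/
theorem continuousOn_pcoFiveG_family (hθ : θ ≤ 1) {A : ℝ → Matrix (Fin 3) (Fin 3) ℝ} {S : Set ℝ}
    (hA : ContinuousOn A S) (K : Set UU) :
    ContinuousOn (fun z : ℝ × UU ↦ pcoFiveG L θ (A z.1) z.2) (S ×ˢ K) := by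
  have h1 : ContinuousOn (fun z : ℝ × UU ↦ A z.1) (S ×ˢ K) :=
    hA.comp continuousOn_fst fun z hz ↦ (Set.mem_prod.1 hz).1
  exact (continuous_pcoFiveG L θ hθ).continuousOn.comp (h1.prodMk continuousOn_snd) (Set.mapsTo_univ _ _)

attribute [local irreducible] pcoFiveG' in
/-- Joint continuity of `𝒢'` along continuous matrix curves `A`, `A'`, where `wᵀAw ≠ 0`. [folklore] -/
theorem continuousOn_pcoFiveG'_family {A A' : ℝ → Matrix (Fin 3) (Fin 3) ℝ} {S : Set ℝ}
    (hA : ContinuousOn A S) (hA' : ContinuousOn A' S) (K : Set UU)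
    (hX : ∀ z ∈ S ×ˢ K, z.2.2 ⬝ᵥ (A z.1 *ᵥ z.2.2) ≠ 0) :
    ContinuousOn (fun z : ℝ × UU ↦ pcoFiveG' L θ (A z.1) (A' z.1) z.2) (S ×ˢ K) := by
  have h1 : ContinuousOn (fun z : ℝ × UU ↦ A z.1) (S ×ˢ K) :=
    hA.comp continuousOn_fst fun z hz ↦ (Set.mem_prod.1 hz).1
  have h2 : ContinuousOn (fun z : ℝ × UU ↦ A' z.1) (S ×ˢ K) :=
    hA'.comp continuousOn_fst fun z hz ↦ (Set.mem_prod.1 hz).1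
  exact (continuousOn_pcoFiveG' L θ).comp (h1.prodMk (h2.prodMk continuousOn_snd)) fun z hz ↦ hX z hz

end Continuity

/-! ### Cor. 7.7 and Lemma 7.8, scalar forms -/

/-- **Hamilton 1986, Cor. 7.7 (scalar form)**: with `Nu = |ᵗBu|²` (`= b̃₃² ≤ b₃²`), `x = a₁ ≤ y = a₃`,
`t = tr A ≤ 3a₃` and (4) in the form `Nu^{1+ε/2} ≤ K x (t/3)`: `Nu ≤ K^{1-θ/2} x^{1-θ} y` for
`θ(2 + ε) = 2ε` ("`b₃² ≤ k a₁^{1-θ} a₃`"). [cite: Hamilton1986, §7, Cor. 7.7 (p. 173)] -/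
theorem lemma77 {Nu K x y t ε θ : ℝ} (hε : 0 < ε) (hθ : θ * (2 + ε) = 2 * ε) (hK : 0 ≤ K)
    (hx : 0 < x) (hxy : x ≤ y) (ht : t ≤ 3 * y) (hNu : 0 ≤ Nu)
    (h4 : Nu ^ (1 + ε / 2) ≤ K * x * (t / 3)) :
    Nu ≤ K ^ (1 - θ / 2) * x ^ (1 - θ) * y := by
  have hy : 0 < y := lt_of_lt_of_le hx hxy
  have hp : 0 < 1 + ε / 2 := by linarith
  have hq : (1 + ε / 2)⁻¹ = 1 - θ / 2 := by
    have h2 : (2 + ε) ≠ 0 := by linarith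
    field_simp
    linarith
  have h1 : Nu ^ (1 + ε / 2) ≤ K * x * y := h4.trans (by nlinarith [mul_nonneg hK hx.le])
  have h2 : Nu ≤ (K * x * y) ^ (1 - θ / 2) := by
    have := Real.rpow_le_rpow (Real.rpow_nonneg hNu _) h1 (inv_pos.2 hp).le
    rwa [Real.rpow_rpow_inv hNu hp.ne', hq] at this
  have e1 : (K * x * y) ^ (1 - θ / 2) = K ^ (1 - θ / 2) * x ^ (1 - θ / 2) * y ^ (1 - θ / 2) := by
    rw [Real.mul_rpow (mul_nonneg hK hx.le) hy.le, Real.mul_rpow hK hx.le]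
  have e2 : y ^ (1 - θ / 2) = y * y ^ (-(θ / 2)) := by
    rw [show (1 - θ / 2) = 1 + (-(θ / 2)) by ring, Real.rpow_add hy, Real.rpow_one]
  have e3 : x ^ (1 - θ / 2) * x ^ (-(θ / 2)) = x ^ (1 - θ) := by
    rw [← Real.rpow_add hx]; congr 1; ring
  have hθ0 : 0 ≤ θ := by nlinarith
  have h3 : y ^ (-(θ / 2)) ≤ x ^ (-(θ / 2)) := Real.rpow_le_rpow_of_nonpos hx hxy (by linarith)
  calc Nu ≤ (K * x * y) ^ (1 - θ / 2) := h2
    _ = K ^ (1 - θ / 2) * x ^ (1 - θ / 2) * (y * y ^ (-(θ / 2))) := by rw [e1, e2]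
    _ ≤ K ^ (1 - θ / 2) * x ^ (1 - θ / 2) * (y * x ^ (-(θ / 2))) := by gcongr
    _ = K ^ (1 - θ / 2) * (x ^ (1 - θ / 2) * x ^ (-(θ / 2))) * y := by ring
    _ = K ^ (1 - θ / 2) * x ^ (1 - θ) * y := by rw [e3]

/-- **Hamilton 1986, Lemma 7.8 (scalar form).** With `x = a₁ ≥ m`, `a = a₂`, `y = a₃ ≤ Hx`,
`X' = x² + |ᵗBw|² + 2a₂a₃` (`= a₁'`), `Y' = y² + |ᵗBu|² + 2a₁a₂` (`= a₃'`), `|ᵗBu|² ≤ k P y` with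
`P = x^{1-θ}`, `P_θ = x^{-θ}` (so `P = x P_θ`), `0 ≤ θ`, `6Hθ ≤ 1`, `L ≥ 2k` and `X' ≤ R`: if
`g = x + LP ≤ y` then `(R/m)(g - y) ≤ g' - Y'` for `g' = X' + L X'(1 - θ)P_θ`
("`d/dt log f ≥ (a₃ - a₁) - (3θHL + k)a₁^{1-θ} ≥ 0` provided `L ≥ 3θHL + k`").
[cite: Hamilton1986, §7, Lemma 7.8 (pp. 173–174)] -/
theorem lemma78 {x y a X' Y' Nw Nu P Pθ L θ k H R m : ℝ} (hm : 0 < m) (hxm : m ≤ x) (hxa : x ≤ a)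
    (hay : a ≤ y) (hyH : y ≤ H * x) (hNw : 0 ≤ Nw)
    (hX' : X' = x ^ 2 + Nw + 2 * (a * y)) (hY' : Y' = y ^ 2 + Nu + 2 * (x * a))
    (hNu : Nu ≤ k * P * y) (hk : 0 ≤ k) (hP : 0 < P) (hPP : P = x * Pθ)
    (hθ0 : 0 ≤ θ) (hθH : 6 * H * θ ≤ 1) (hL : 2 * k ≤ L) (hle : x + L * P - y ≤ 0)
    (hXR : X' ≤ R) :
    R / m * (x + L * P - y) ≤ (X' + L * (X' * (1 - θ) * Pθ)) - Y' := by
  have hx : 0 < x := by linarith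
  have hy : 0 < y := by linarith
  have hH1 : 1 ≤ H := by nlinarith
  have hθ1 : θ ≤ 1 := by nlinarith
  have hL0 : 0 ≤ L := by linarith
  have hgx : x ≤ x + L * P := by nlinarith
  have hgpos : 0 < x + L * P := by linarith
  have hX'low : x * (x + 2 * y) ≤ X' := by rw [hX']; nlinarith
  have hX'pos : 0 < X' := lt_of_lt_of_le (by positivity) hX'low
  have hR0 : 0 ≤ R := hX'pos.le.trans hXR
  have eg' : (X' + L * (X' * (1 - θ) * Pθ)) * x = X' * (x + (1 - θ) * L * P) := by rw [hPP]; ring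
  have hfac : 0 ≤ x + (1 - θ) * L * P := by
    have := mul_nonneg (mul_nonneg (sub_nonneg.2 hθ1) hL0) hP.le
    linarith
  have hg'low : (x + 2 * y) * (x + L * P - θ * L * P) ≤ X' + L * (X' * (1 - θ) * Pθ) := by
    have h1 : (x + 2 * y) * (x + L * P - θ * L * P) * x ≤ (X' + L * (X' * (1 - θ) * Pθ)) * x := by
      rw [eg']
      calc (x + 2 * y) * (x + L * P - θ * L * P) * x = x * (x + 2 * y) * (x + (1 - θ) * L * P) := by ring
        _ ≤ X' * (x + (1 - θ) * L * P) := mul_le_mul_of_nonneg_right hX'low hfac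
    exact le_of_mul_le_mul_right h1 hx
  have hY'up : Y' ≤ y ^ 2 + 2 * (x * y) + k * P * y := by
    rw [hY']
    have := mul_le_mul_of_nonneg_left hay hx.le
    linarith
  have h3 : x + 2 * y ≤ 3 * H * x := by nlinarith
  have h4 : θ * L * P * (x + 2 * y) ≤ L / 2 * P * x := by
    have h4a := mul_le_mul_of_nonneg_left h3 (by positivity : 0 ≤ θ * L * P)
    have h4b : θ * L * P * (3 * H * x) ≤ L / 2 * P * x := by
      have := mul_le_mul_of_nonneg_right hθH (show 0 ≤ L * P * x by positivity)
      linarith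
    exact h4a.trans h4b
  have hyx : L * P ≤ y - x := by linarith
  have key : 0 ≤ (x + L * P) * (y - x) - k * P * (x + L * P) - θ * L * P * (x + 2 * y) := by
    have s1 : (x + L * P) * (L * P) ≤ (x + L * P) * (y - x) := mul_le_mul_of_nonneg_left hyx hgpos.le
    have s2 : k * (P * (x + L * P)) ≤ L / 2 * (P * (x + L * P)) :=
      mul_le_mul_of_nonneg_right (by linarith) (mul_nonneg hP.le hgpos.le)
    have s4 : 0 ≤ L / 2 * P * (x + L * P - x) := mul_nonneg (mul_nonneg (by linarith) hP.le) (by linarith)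
    linarith [s1, s2, h4, s4]
  have hd : (x + L * P) * Y' ≤ y * (X' + L * (X' * (1 - θ) * Pθ)) := by
    have a1 := mul_le_mul_of_nonneg_left hg'low hy.le
    have a2 := mul_le_mul_of_nonneg_left hY'up hgpos.le
    have mid := mul_nonneg hy.le key
    linarith [a1, a2, mid]
  have hg'up : X' + L * (X' * (1 - θ) * Pθ) ≤ R / m * (x + L * P) := by
    have h1 : (X' + L * (X' * (1 - θ) * Pθ)) * x ≤ X' * (x + L * P) := by
      rw [eg']
      apply mul_le_mul_of_nonneg_left _ hX'pos.le
      have := mul_nonneg (mul_nonneg hθ0 hL0) hP.le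
      linarith
    have hXx : X' ≤ R / m * x := by
      have : R ≤ R / m * x := by
        rw [div_mul_eq_mul_div, le_div_iff₀ hm]; exact mul_le_mul_of_nonneg_left hxm hR0
      linarith
    have h2 : X' * (x + L * P) ≤ R / m * (x + L * P) * x := by
      have := mul_le_mul_of_nonneg_right hXx hgpos.le
      linarith
    exact le_of_mul_le_mul_right (h1.trans h2) hx
  have hfin : R / m * (x + L * P - y) * (x + L * P) ≤ ((X' + L * (X' * (1 - θ) * Pθ)) - Y') * (x + L * P) := by
    have t := mul_nonneg_of_nonpos_of_nonpos hle (sub_nonpos.2 hg'up)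
    linarith [t, hd]
  exact le_of_mul_le_mul_right hfin hgpos

/-! ### Consequences of (4): `b̃₃^{2+ε} ≤ K a₁ c₁` for single products -/

/-- **From (4): `((uᵀBv)²)^{1+ε/2} ≤ K (wᵀAw)(zᵀCz)` for unit `u, v, w, z`** (complete to frames
`(u, u₂)`, `(v, ±v₂)`: `s² ≤ max((s + t)², (s - t)²)`). [cite: Hamilton1986, §7, Cor. 7.7 (p. 173)] -/
theorem SingularValuesSumPowLEProd.rpow_sq_bilin_le {p : Blocks} {K ε : ℝ}
    (h : SingularValuesSumPowLEProd p K ε) (hε : 0 < ε) {u v w z : Fin 3 → ℝ} (hu : u ⬝ᵥ u = 1)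
    (hv : v ⬝ᵥ v = 1) (hw : w ⬝ᵥ w = 1) (hz : z ⬝ᵥ z = 1) :
    ((u ⬝ᵥ (p.2.1 *ᵥ v)) ^ 2) ^ (1 + ε / 2) ≤ K * (w ⬝ᵥ (p.1 *ᵥ w)) * (z ⬝ᵥ (p.2.2 *ᵥ z)) := by
  obtain ⟨u₂, -, hu₂, -, huu₂, -, -⟩ := exists_orthonormal_complement hu
  obtain ⟨v₂, -, hv₂, -, hvv₂, -, -⟩ := exists_orthonormal_complement hv
  have hp := h u u₂ v v₂ w z hu hu₂ huu₂ hv hv₂ hvv₂ hw hz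
  have hn := h u u₂ v (-v₂) w z hu hu₂ huu₂ hv (by simpa using hv₂) (by simp [hvv₂]) hw hz
  simp only [Matrix.mulVec_neg, dotProduct_neg] at hn
  have hp1 : 0 < 1 + ε / 2 := by linarith
  set s := u ⬝ᵥ (p.2.1 *ᵥ v)
  set t := u₂ ⬝ᵥ (p.2.1 *ᵥ v₂)
  rcases le_or_gt 0 (s * t) with hst | hst
  · have h1 : s ^ 2 ≤ (s + t) ^ 2 := by nlinarith
    exact (Real.rpow_le_rpow (sq_nonneg _) h1 hp1.le).trans hp
  · have h1 : s ^ 2 ≤ (s + -t) ^ 2 := by nlinarith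
    exact (Real.rpow_le_rpow (sq_nonneg _) h1 hp1.le).trans hn

/-- `(|ᵗNu|²)^p ≤ Q` as soon as `((uᵀNv)²)^p ≤ Q` for all unit `v` (`p > 0`). [folklore] -/
theorem rpow_normSq_transpose_mulVec_le {N : Matrix (Fin 3) (Fin 3) ℝ} {u : Fin 3 → ℝ} {Q p : ℝ}
    (hp : 0 < p) (h : ∀ v : Fin 3 → ℝ, v ⬝ᵥ v = 1 → ((u ⬝ᵥ (N *ᵥ v)) ^ 2) ^ p ≤ Q) :
    ((Nᵀ *ᵥ u) ⬝ᵥ (Nᵀ *ᵥ u)) ^ p ≤ Q := by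
  have hQ : 0 ≤ Q := (Real.rpow_nonneg (sq_nonneg _) _).trans (h ![1, 0, 0] (by simp [dotProduct, Fin.sum_univ_three]))
  have h1 : ∀ v : Fin 3 → ℝ, v ⬝ᵥ v = 1 → (u ⬝ᵥ (N *ᵥ v)) ^ 2 ≤ Q ^ p⁻¹ := by
    intro v hv
    have := Real.rpow_le_rpow (Real.rpow_nonneg (sq_nonneg _) _) (h v hv) (inv_pos.2 hp).le
    rwa [Real.rpow_rpow_inv (sq_nonneg _) hp.ne'] at this
  have h2 := normSq_transpose_mulVec_le_of_sq_le h1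
  have h3 := Real.rpow_le_rpow (Finset.sum_nonneg fun i _ ↦ mul_self_nonneg _) h2 hp.le
  rwa [Real.rpow_inv_rpow hQ hp.ne'] at h3

/-- **The bound on `|ᵗBu|²` used for block `A`**: under (4), `tr A = tr C`, `K ≥ 0` and `wᵀAw ≥ 0`:
`(|ᵗBu|²)^{1+ε/2} ≤ K (wᵀAw)(tr A / 3)` for unit `u, w`. [cite: Hamilton1986, §7, Cor. 7.7 (p. 173)] -/
theorem SingularValuesSumPowLEProd.rpow_normSq_transpose_le {p : Blocks} {K ε : ℝ}
    (h : SingularValuesSumPowLEProd p K ε) (hε : 0 < ε) (hK : 0 ≤ K) (htr : p.1.trace = p.2.2.trace)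
    {u w : Fin 3 → ℝ} (hu : u ⬝ᵥ u = 1) (hw : w ⬝ᵥ w = 1) (hw0 : 0 ≤ w ⬝ᵥ (p.1 *ᵥ w)) :
    ((p.2.1ᵀ *ᵥ u) ⬝ᵥ (p.2.1ᵀ *ᵥ u)) ^ (1 + ε / 2) ≤ K * (w ⬝ᵥ (p.1 *ᵥ w)) * (p.1.trace / 3) := by
  obtain ⟨z₀, hz₀, hz₀le⟩ := exists_unit_rayleigh_le_trace_div_three p.2.2
  have h1 := rpow_normSq_transpose_mulVec_le (N := p.2.1) (u := u) (by linarith : 0 < 1 + ε / 2)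
    fun v hv ↦ h.rpow_sq_bilin_le hε hu hv hw hz₀
  refine h1.trans ?_
  rw [htr]
  exact mul_le_mul_of_nonneg_left hz₀le (mul_nonneg hK hw0)

/-- **The bound on `|Bu|²` used for block `C`** ("a similar argument works for the inequality in
`c`"). [cite: Hamilton1986, §7, Cor. 7.7 and Lemma 7.8 (pp. 173–174)] -/
theorem SingularValuesSumPowLEProd.rpow_normSq_le {p : Blocks} {K ε : ℝ}
    (h : SingularValuesSumPowLEProd p K ε) (hε : 0 < ε) (hK : 0 ≤ K) (htr : p.1.trace = p.2.2.trace)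
    {u w : Fin 3 → ℝ} (hu : u ⬝ᵥ u = 1) (hw : w ⬝ᵥ w = 1) (hw0 : 0 ≤ w ⬝ᵥ (p.2.2 *ᵥ w)) :
    ((p.2.1ᵀᵀ *ᵥ u) ⬝ᵥ (p.2.1ᵀᵀ *ᵥ u)) ^ (1 + ε / 2) ≤ K * (w ⬝ᵥ (p.2.2 *ᵥ w)) * (p.2.2.trace / 3) := by
  obtain ⟨z₀, hz₀, hz₀le⟩ := exists_unit_rayleigh_le_trace_div_three p.1
  have h1 := rpow_normSq_transpose_mulVec_le (N := p.2.1ᵀ) (u := u)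
    (Q := K * (z₀ ⬝ᵥ (p.1 *ᵥ z₀)) * (w ⬝ᵥ (p.2.2 *ᵥ w))) (by linarith : 0 < 1 + ε / 2) fun v hv ↦ by
      rw [Matrix.dotProduct_transpose_mulVec]
      exact h.rpow_sq_bilin_le hε hv hu hz₀ hw
  refine h1.trans ?_
  rw [← htr]
  have h2 := mul_le_mul_of_nonneg_left hz₀le (mul_nonneg hK hw0)
  nlinarith [h2]

/-! ### The sign condition at a minimiser (Hamilton 1986, Lemma 7.8) -/

variable {M N : Matrix (Fin 3) (Fin 3) ℝ}

/-- `t ↦ t + L t^{1-θ}` is increasing on `t > 0` (`L ≥ 0`, `θ ≤ 1`): so at a minimiser of `𝒢`,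
`w` minimises the Rayleigh quotient. [folklore] -/
theorem le_of_add_rpow_le {L θ s t : ℝ} (hL : 0 ≤ L) (hθ : θ ≤ 1) (ht : 0 < t)
    (h : s + L * s ^ (1 - θ) ≤ t + L * t ^ (1 - θ)) : s ≤ t := by
  by_contra hcon
  rw [not_le] at hcon
  have h1 : t ^ (1 - θ) ≤ s ^ (1 - θ) := Real.rpow_le_rpow ht.le hcon.le (by linarith)
  have h2 := mul_le_mul_of_nonneg_left h1 hL
  linarith

/-- **Hamilton 1986, Lemma 7.8: the differential inequality at the extremal unit vectors.** Let `M`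
be symmetric with `a₁ ≥ m > 0` and `a₃ ≤ Ha₁`, let `(|ᵗNu|²)^{1+ε/2} ≤ K (wᵀMw)(tr M/3)` (the
consequence of (4)), `0 < K`, `0 < ε`, `θ(2 + ε) = 2ε`, `6Hθ ≤ 1`, `2K^{1-θ/2} ≤ L`, `Σ|M'| ≤ R`,
and let `w` minimise and `u` maximise the Rayleigh quotient with
`𝒢 = wᵀMw + L(wᵀMw)^{1-θ} - uᵀMu ≤ 0`. Then `(R/m) 𝒢 ≤ 𝒢'` for `M' = M² + NᵗN + 2M#`.
[cite: Hamilton1986, §7, Cor. 7.7, Lemma 7.8 (pp. 173–174)] -/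
theorem pcoFive_deriv (hM : M.IsSymm) {m H K ε θ L R : ℝ} (hm : 0 < m) (hK : 0 < K) (hε : 0 < ε)
    (hθε : θ * (2 + ε) = 2 * ε) (hθ1 : θ ≤ 1) (hθH : 6 * H * θ ≤ 1) (hL : 2 * K ^ (1 - θ / 2) ≤ L)
    (h1 : ∀ w : Fin 3 → ℝ, w ⬝ᵥ w = 1 → m ≤ w ⬝ᵥ (M *ᵥ w)) (h2 : M.LargestLESmallestAdd H 0)
    (hR : ∑ k, ∑ l, |(M * M + N * Nᵀ + (2 : ℝ) • M.sharp) k l| ≤ R)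
    {u w : Fin 3 → ℝ} (hu : u ⬝ᵥ u = 1) (hw : w ⬝ᵥ w = 1)
    (hmax : ∀ z ∈ unitSet, z ⬝ᵥ (M *ᵥ z) ≤ u ⬝ᵥ (M *ᵥ u))
    (hmin : ∀ z ∈ unitSet, w ⬝ᵥ (M *ᵥ w) ≤ z ⬝ᵥ (M *ᵥ z))
    (hNu : ((Nᵀ *ᵥ u) ⬝ᵥ (Nᵀ *ᵥ u)) ^ (1 + ε / 2) ≤ K * (w ⬝ᵥ (M *ᵥ w)) * (M.trace / 3))
    (hle : w ⬝ᵥ (M *ᵥ w) + L * (w ⬝ᵥ (M *ᵥ w)) ^ (1 - θ) - u ⬝ᵥ (M *ᵥ u) ≤ 0) :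
    R / m * (w ⬝ᵥ (M *ᵥ w) + L * (w ⬝ᵥ (M *ᵥ w)) ^ (1 - θ) - u ⬝ᵥ (M *ᵥ u)) ≤
      (w ⬝ᵥ ((M * M + N * Nᵀ + (2 : ℝ) • M.sharp) *ᵥ w) +
          L * (w ⬝ᵥ ((M * M + N * Nᵀ + (2 : ℝ) • M.sharp) *ᵥ w) * (1 - θ) *
            (w ⬝ᵥ (M *ᵥ w)) ^ (1 - θ - 1))) -
        u ⬝ᵥ ((M * M + N * Nᵀ + (2 : ℝ) • M.sharp) *ᵥ u) := by
  have hu0 : ∀ z : Fin 3 → ℝ, z ⬝ᵥ u = 0 → u ⬝ᵥ (M *ᵥ z) = 0 :=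
    fun z hz ↦ cross_eq_zero_of_max hM hu hmax hz
  have hw0 : ∀ z : Fin 3 → ℝ, z ⬝ᵥ w = 0 → w ⬝ᵥ (M *ᵥ z) = 0 :=
    fun z hz ↦ cross_eq_zero_of_min hM hw hmin hz
  -- constants
  have hθ0 : 0 ≤ θ := by nlinarith
  have hk : 0 ≤ K ^ (1 - θ / 2) := Real.rpow_nonneg hK.le _
  have hL0 : 0 < L := by
    have : 0 < K ^ (1 - θ / 2) := Real.rpow_pos_of_pos hK _
    linarith
  -- `x = a₁ ≥ m > 0`, `y = a₃ ≥ x + L x^{1-θ} > x`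
  have hx : m ≤ w ⬝ᵥ (M *ᵥ w) := h1 w hw
  have hxpos : 0 < w ⬝ᵥ (M *ᵥ w) := by linarith
  have hPpos : 0 < (w ⬝ᵥ (M *ᵥ w)) ^ (1 - θ) := Real.rpow_pos_of_pos hxpos _
  have hlt : w ⬝ᵥ (M *ᵥ w) < u ⬝ᵥ (M *ᵥ u) := by nlinarith [mul_pos hL0 hPpos]
  -- `u ⊥ w`, eigenbasis `(w, n, u)` with `n = w × u`
  have huw : u ⬝ᵥ w = 0 := dot_eq_zero_of_eigen hM hu hw hu0 hw0 hlt.ne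
  have hwu : w ⬝ᵥ u = 0 := by rw [dotProduct_comm]; exact huw
  set n := w ⨯₃ u with hn
  have hn1 : n ⬝ᵥ n = 1 := dotProduct_cross_self_of_orthonormal hw hu hwu
  have hwn : w ⬝ᵥ n = 0 := dot_self_cross w u
  have hun : u ⬝ᵥ n = 0 := dot_cross_self w u
  have hnw : n ⬝ᵥ w = 0 := by rw [dotProduct_comm]; exact hwn
  have hnu : n ⬝ᵥ u = 0 := by rw [dotProduct_comm]; exact hun
  have cwn : w ⬝ᵥ (M *ᵥ n) = 0 := hw0 n hnw
  have cwu : w ⬝ᵥ (M *ᵥ u) = 0 := hw0 u huw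
  have cnu : n ⬝ᵥ (M *ᵥ u) = 0 := by rw [quad_comm_of_isSymm hM]; exact hu0 n hnu
  have cnw : n ⬝ᵥ (M *ᵥ w) = 0 := by rw [quad_comm_of_isSymm hM]; exact cwn
  have cuw : u ⬝ᵥ (M *ᵥ w) = 0 := by rw [quad_comm_of_isSymm hM]; exact cwu
  have Eu := quad_field_eq_of_diag (N := N) hM hw hn1 hu hwn hwu hnu cwn cwu cnu
  have Ew := quad_field_eq_of_diag (N := N) hM hn1 hu hw hnu hnw huw cnu cnw cuw
  rw [Eu, Ew]
  -- the scalars `x ≤ a ≤ y`, `tr M = x + a + y`, `y ≤ Hx`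
  have ha2x : w ⬝ᵥ (M *ᵥ w) ≤ n ⬝ᵥ (M *ᵥ n) := hmin n hn1
  have ha2y : n ⬝ᵥ (M *ᵥ n) ≤ u ⬝ᵥ (M *ᵥ u) := hmax n hn1
  have htr : w ⬝ᵥ (M *ᵥ w) + n ⬝ᵥ (M *ᵥ n) + u ⬝ᵥ (M *ᵥ u) = M.trace :=
    sum_quadratic_eq_trace_of_orthonormal M hw hn1 hu hwn hwu hnu
  have hyH : u ⬝ᵥ (M *ᵥ u) ≤ H * (w ⬝ᵥ (M *ᵥ w)) := by have := h2 u w hu hw; rwa [add_zero] at this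
  -- Cor. 7.7
  have hNu' := lemma77 hε hθε hK.le hxpos hlt.le (by rw [← htr]; linarith)
    (Finset.sum_nonneg fun i _ ↦ mul_self_nonneg _) hNu
  -- `X' ≤ R`
  have hXR : (w ⬝ᵥ (M *ᵥ w)) ^ 2 + (Nᵀ *ᵥ w) ⬝ᵥ (Nᵀ *ᵥ w) + 2 * ((n ⬝ᵥ (M *ᵥ n)) * (u ⬝ᵥ (M *ᵥ u))) ≤ R := by
    rw [← Ew]
    exact ((abs_le.1 (abs_quad_le_sum _ hw)).2).trans hR
  -- powers: `x^{1-θ} = x · x^{-θ}`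
  have e1 : (1 - θ - 1) = -θ := by ring
  rw [e1]
  have hPP : (w ⬝ᵥ (M *ᵥ w)) ^ (1 - θ) = (w ⬝ᵥ (M *ᵥ w)) * (w ⬝ᵥ (M *ᵥ w)) ^ (-θ) := by
    rw [show (1 - θ) = 1 + (-θ) by ring, Real.rpow_add hxpos, Real.rpow_one]
  exact lemma78 hm hx ha2x ha2y hyH (Finset.sum_nonneg fun i _ ↦ mul_self_nonneg _) rfl rfl hNu' hk hPpos
    hPP hθ0 hθH hL hle hXR

/-- **The sign condition at a minimiser of `𝒢`** (pointwise, Lemma 7.8): with the data of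
`pcoFive_deriv` for all unit `u`, `w`, at a minimiser `q = (u, w)` of `𝒢` over `unitSet²` with
`𝒢(q) ≤ 0`: `(R/m) 𝒢 ≤ 𝒢'`. [cite: Hamilton1986, §7, Lemma 7.8 (pp. 173–174)] -/
theorem pcoFive_sign (hM : M.IsSymm) {m H K ε θ L R : ℝ} (hm : 0 < m) (hK : 0 < K) (hε : 0 < ε)
    (hθε : θ * (2 + ε) = 2 * ε) (hθ1 : θ ≤ 1) (hθH : 6 * H * θ ≤ 1) (hL : 2 * K ^ (1 - θ / 2) ≤ L)
    (h1 : ∀ w : Fin 3 → ℝ, w ⬝ᵥ w = 1 → m ≤ w ⬝ᵥ (M *ᵥ w)) (h2 : M.LargestLESmallestAdd H 0)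
    (hR : ∑ k, ∑ l, |(M * M + N * Nᵀ + (2 : ℝ) • M.sharp) k l| ≤ R)
    (hNB : ∀ u w : Fin 3 → ℝ, u ⬝ᵥ u = 1 → w ⬝ᵥ w = 1 →
      ((Nᵀ *ᵥ u) ⬝ᵥ (Nᵀ *ᵥ u)) ^ (1 + ε / 2) ≤ K * (w ⬝ᵥ (M *ᵥ w)) * (M.trace / 3))
    {q : UU} (hq : q ∈ (unitSet ×ˢ unitSet : Set UU))
    (hqmin : IsMinOn (pcoFiveG L θ M) (unitSet ×ˢ unitSet) q) (hle : pcoFiveG L θ M q ≤ 0) :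
    R / m * pcoFiveG L θ M q ≤ pcoFiveG' L θ M (M * M + N * Nᵀ + (2 : ℝ) • M.sharp) q := by
  obtain ⟨u, w⟩ := q
  obtain ⟨hu, hw⟩ := hq
  have hu1 : u ⬝ᵥ u = 1 := hu
  have hw1 : w ⬝ᵥ w = 1 := hw
  have hL0 : 0 ≤ L := le_trans (by positivity) hL
  -- decoupling: `u` maximises, `w` minimises
  have hmax : ∀ z ∈ unitSet, z ⬝ᵥ (M *ᵥ z) ≤ u ⬝ᵥ (M *ᵥ u) := by
    intro z hz
    have h := hqmin (show (z, w) ∈ (unitSet ×ˢ unitSet : Set UU) from ⟨hz, hw⟩)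
    simp only [mem_setOf_eq, pcoFiveG] at h
    linarith
  have hmin : ∀ z ∈ unitSet, w ⬝ᵥ (M *ᵥ w) ≤ z ⬝ᵥ (M *ᵥ z) := by
    intro z hz
    have h := hqmin (show (u, z) ∈ (unitSet ×ˢ unitSet : Set UU) from ⟨hu, hz⟩)
    simp only [mem_setOf_eq, pcoFiveG] at h
    exact le_of_add_rpow_le hL0 hθ1 (by linarith [h1 z hz]) (by linarith)
  have h := pcoFive_deriv (N := N) hM hm hK hε hθε hθ1 hθH hL h1 h2 hR hu1 hw1 hmax hmin (hNB u w hu1 hw1) hle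
  simpa only [pcoFiveG, pcoFiveG'] using h

/-! ### Thm. 7.1 (5), ODE part -/

section

variable (L θ : ℝ)

/-- The abstract step: the barrier lemma for `𝒢` along a matrix curve `M` with field-shaped
derivative `M' = M² + NᵗN + 2M#`, under `a₁ ≥ m`, `a₃ ≤ Ha₁` and the bound from (4).
[cite: Hamilton1986, §7, Lemma 7.8 (pp. 173–174)] -/
theorem pcoFive_preserved {M N M' : ℝ → Matrix (Fin 3) (Fin 3) ℝ} {t₀ t₁ m H K ε : ℝ}
    (h₁ : t₀ ≤ t₁) (hm : 0 < m) (hK : 0 < K) (hε : 0 < ε) (hθε : θ * (2 + ε) = 2 * ε)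
    (hθ1 : θ ≤ 1) (hθH : 6 * H * θ ≤ 1) (hL : 2 * K ^ (1 - θ / 2) ≤ L)
    (hMc : ContinuousOn M (Icc t₀ t₁)) (hM'c : ContinuousOn M' (Icc t₀ t₁))
    (hM'eq : ∀ s ∈ Icc t₀ t₁, M' s = M s * M s + N s * (N s)ᵀ + (2 : ℝ) • (M s).sharp)
    (hderiv : ∀ s ∈ Icc t₀ t₁, ∀ k l, _root_.HasDerivAt (fun t ↦ M t k l) (M' s k l) s)
    (hsymm : ∀ s ∈ Icc t₀ t₁, (M s).IsSymm)
    (h1 : ∀ s ∈ Icc t₀ t₁, ∀ w : Fin 3 → ℝ, w ⬝ᵥ w = 1 → m ≤ w ⬝ᵥ (M s *ᵥ w))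
    (h2 : ∀ s ∈ Icc t₀ t₁, (M s).LargestLESmallestAdd H 0)
    (hNB : ∀ s ∈ Ico t₀ t₁, ∀ u w : Fin 3 → ℝ, u ⬝ᵥ u = 1 → w ⬝ᵥ w = 1 →
      (((N s)ᵀ *ᵥ u) ⬝ᵥ ((N s)ᵀ *ᵥ u)) ^ (1 + ε / 2) ≤ K * (w ⬝ᵥ (M s *ᵥ w)) * ((M s).trace / 3))
    (h0 : LargestLESmallestAddPow (M t₀) L θ) : LargestLESmallestAddPow (M t₁) L θ := by
  have hKset : IsCompact (unitSet ×ˢ unitSet : Set UU) := isCompact_unitSet.prod isCompact_unitSet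
  have hKne : (unitSet ×ˢ unitSet : Set UU).Nonempty := unitSet_nonempty.prod unitSet_nonempty
  have hXne : ∀ z ∈ Icc t₀ t₁ ×ˢ (unitSet ×ˢ unitSet : Set UU), z.2.2 ⬝ᵥ (M z.1 *ᵥ z.2.2) ≠ 0 := by
    rintro ⟨s, u, w⟩ ⟨hs, -, hw⟩
    have := h1 s hs w hw
    exact ne_of_gt (by simp only; linarith)
  have hGc := continuousOn_pcoFiveG_family L θ hθ1 hMc (unitSet ×ˢ unitSet)
  have hG'c := continuousOn_pcoFiveG'_family L θ hMc hM'c (unitSet ×ˢ unitSet) hXne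
  have hGd : ∀ q ∈ (unitSet ×ˢ unitSet : Set UU), ∀ s ∈ Icc t₀ t₁,
      _root_.HasDerivAt (fun t ↦ pcoFiveG L θ (M t) q) (pcoFiveG' L θ (M s) (M' s) q) s :=
    fun q hq s hs ↦ hasDerivAt_pcoFiveG L θ (hderiv s hs) q (hXne (s, q) ⟨hs, hq⟩)
  -- uniform bound `R` for `Σ|M'|`
  have hScont : ContinuousOn (fun t ↦ ∑ k, ∑ l, |M' t k l|) (Icc t₀ t₁) :=
    continuousOn_finsetSum _ fun k _ ↦ continuousOn_finsetSum _ fun l _ ↦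
      ((continuousOn_pi.1 (continuousOn_pi.1 hM'c k) l)).abs
  obtain ⟨sR, -, hRmax⟩ := isCompact_Icc.exists_isMaxOn (nonempty_Icc.2 h₁) hScont
  set R := ∑ k, ∑ l, |M' sR k l| with hRdef
  have hR' : ∀ s ∈ Icc t₀ t₁, ∑ k, ∑ l, |M' s k l| ≤ R := fun s hs ↦ hRmax hs
  have hR0 : 0 ≤ R := Finset.sum_nonneg fun k _ ↦ Finset.sum_nonneg fun l _ ↦ abs_nonneg _
  have hC0 : 0 ≤ R / m := div_nonneg hR0 hm.le
  have key := minOverSet_nonneg_of_deriv (G := fun t q ↦ pcoFiveG L θ (M t) q)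
    (G' := fun t q ↦ pcoFiveG' L θ (M t) (M' t) q) hKset hKne hGc hGd hG'c h₁ one_pos hC0 (η := 1)
    (fun s hs q hq hqmin _ hle ↦ ?_) ?_
  · rw [largestLESmallestAddPow_iff]
    exact (le_minOverSet_iff hKset hKne (continuousOn_slice (G := fun t q ↦ pcoFiveG L θ (M t) q)
      hGc (right_mem_Icc.2 h₁)) 0).1 key
  · have hsI : s ∈ Icc t₀ t₁ := Ico_subset_Icc_self hs
    have hRs : ∑ k, ∑ l, |(M s * M s + N s * (N s)ᵀ + (2 : ℝ) • (M s).sharp) k l| ≤ R := by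
      rw [← hM'eq s hsI]; exact hR' s hsI
    have h := pcoFive_sign (N := N s) (hsymm s hsI) hm hK hε hθε hθ1 hθH hL (h1 s hsI) (h2 s hsI) hRs
      (hNB s hs) hq hqmin hle
    simpa only [hM'eq s hsI] using h
  · refine (le_minOverSet_iff hKset hKne (continuousOn_slice (G := fun t q ↦ pcoFiveG L θ (M t) q)
      hGc (left_mem_Icc.2 h₁)) 0).2 ?_
    exact (largestLESmallestAddPow_iff L θ (M t₀)).1 h0

end

/-- The constraint set for (5), `{A, C symmetric} ∩ {tr A = tr C} ∩ {M ≥ m} ∩ {(2)} ∩ {(4)}`, contains `Z₄`. [folklore] -/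
theorem pcoPinchingFour_subset {m G H J δ K ε : ℝ} :
    pcoPinchingFour m G H J δ K ε ⊆ {p : Blocks | (p.1.IsSymm ∧ p.2.2.IsSymm) ∧ p.1.trace = p.2.2.trace ∧
      OperatorGE p m ∧ (p.1.LargestLESmallestAdd H 0 ∧ p.2.2.LargestLESmallestAdd H 0) ∧
      SingularValuesSumPowLEProd p K ε} :=
  fun _ hp ↦ ⟨hp.1.1.1, hp.1.1.2.1, hp.1.1.2.2.1, ⟨hp.1.1.2.2.2.2.1, hp.1.1.2.2.2.2.2⟩, hp.2⟩

/-- **Hamilton 1986, Thm. 7.1 (5), ODE part, block `A` (proved)**: `{a₃ ≤ a₁ + L a₁^{1-θ}}` is forward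
invariant relative to `{A, C symmetric} ∩ {tr A = tr C} ∩ {M ≥ m} ∩ {(2)} ∩ {(4)}` for
`0 < m, K, ε`, `θ(2 + ε) = 2ε`, `6Hθ ≤ 1`, `2K^{1-θ/2} ≤ L`. [cite: Hamilton1986, §7, Lemma 7.8 (pp. 173–174)] -/
theorem isInvariantRel_pcoFive_fst {m H K ε θ L : ℝ} (hm : 0 < m) (hK : 0 < K) (hε : 0 < ε)
    (hθε : θ * (2 + ε) = 2 * ε) (hθ1 : θ ≤ 1) (hθH : 6 * H * θ ≤ 1) (hL : 2 * K ^ (1 - θ / 2) ≤ L) :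
    IsInvariantRel field
      (fun _ ↦ {p : Blocks | (p.1.IsSymm ∧ p.2.2.IsSymm) ∧ p.1.trace = p.2.2.trace ∧
        OperatorGE p m ∧ (p.1.LargestLESmallestAdd H 0 ∧ p.2.2.LargestLESmallestAdd H 0) ∧
        SingularValuesSumPowLEProd p K ε})
      (fun _ ↦ {p | LargestLESmallestAddPow p.1 L θ}) := by
  intro γ t₀ t₁ _ h₁ hγ hKc hin
  have hγc := IsSolutionOn.continuousOn hγ
  refine pcoFive_preserved L θ (M := fun s ↦ (γ s).1) (N := fun s ↦ (γ s).2.1)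
    (M' := fun s ↦ (field (γ s)).1) h₁ hm hK hε hθε hθ1 hθH hL (continuousOn_fst.comp hγc (mapsTo_univ _ _))
    (continuousOn_fst.comp (continuous_field.comp_continuousOn hγc) (mapsTo_univ _ _))
    (fun s _ ↦ rfl) (fun s hs k l ↦ (hγ s hs).1 k l) (fun s hs ↦ (hKc s hs).1.1)
    (fun s hs w hw ↦ ?_) (fun s hs ↦ (hKc s hs).2.2.2.1.1) (fun s hs u w hu hw ↦ ?_) hin
  · have := (hKc s hs).2.2.1.quad_fst w
    rw [hw, mul_one] at this
    exact this
  · obtain ⟨-, htr, hop, -, hfour⟩ := hKc s (Ico_subset_Icc_self hs)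
    have hw0 : 0 ≤ w ⬝ᵥ ((γ s).1 *ᵥ w) := by
      have := hop.quad_fst w; rw [hw, mul_one] at this; linarith
    exact hfour.rpow_normSq_transpose_le hε hK.le htr hu hw hw0

/-- **Hamilton 1986, Thm. 7.1 (5), ODE part, block `C` (proved)** ("A similar argument works for the
inequality in `c`"). [cite: Hamilton1986, §7, Lemma 7.8 (p. 174)] -/
theorem isInvariantRel_pcoFive_snd {m H K ε θ L : ℝ} (hm : 0 < m) (hK : 0 < K) (hε : 0 < ε)
    (hθε : θ * (2 + ε) = 2 * ε) (hθ1 : θ ≤ 1) (hθH : 6 * H * θ ≤ 1) (hL : 2 * K ^ (1 - θ / 2) ≤ L) :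
    IsInvariantRel field
      (fun _ ↦ {p : Blocks | (p.1.IsSymm ∧ p.2.2.IsSymm) ∧ p.1.trace = p.2.2.trace ∧
        OperatorGE p m ∧ (p.1.LargestLESmallestAdd H 0 ∧ p.2.2.LargestLESmallestAdd H 0) ∧
        SingularValuesSumPowLEProd p K ε})
      (fun _ ↦ {p | LargestLESmallestAddPow p.2.2 L θ}) := by
  intro γ t₀ t₁ _ h₁ hγ hKc hin
  have hγc := IsSolutionOn.continuousOn hγ
  refine pcoFive_preserved L θ (M := fun s ↦ (γ s).2.2) (N := fun s ↦ (γ s).2.1ᵀ)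
    (M' := fun s ↦ (field (γ s)).2.2) h₁ hm hK hε hθε hθ1 hθH hL
    ((continuousOn_snd.comp continuousOn_snd (mapsTo_univ _ _)).comp hγc (mapsTo_univ _ _))
    ((continuousOn_snd.comp continuousOn_snd (mapsTo_univ _ _)).comp
      (continuous_field.comp_continuousOn hγc) (mapsTo_univ _ _))
    (fun s _ ↦ field_snd_snd (γ s)) (fun s hs k l ↦ (hγ s hs).2.2 k l) (fun s hs ↦ (hKc s hs).1.2)
    (fun s hs w hw ↦ ?_) (fun s hs ↦ (hKc s hs).2.2.2.1.2) (fun s hs u w hu hw ↦ ?_) hin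
  · have := (hKc s hs).2.2.1.quad_snd_snd w
    rw [hw, mul_one] at this
    exact this
  · obtain ⟨-, htr, hop, -, hfour⟩ := hKc s (Ico_subset_Icc_self hs)
    have hw0 : 0 ≤ w ⬝ᵥ ((γ s).2.2 *ᵥ w) := by
      have := hop.quad_snd_snd w; rw [hw, mul_one] at this; linarith
    exact hfour.rpow_normSq_le hε hK.le htr hu hw hw0

/-- **Hamilton 1986, Thm. 7.1, inequality (5), ODE part (proved)**: for `0 < m, K, ε`,
`θ(2 + ε) = 2ε`, `6Hθ ≤ 1` and `2K^{1-θ/2} ≤ L`, the set `{a₃ ≤ a₁ + La₁^{1-θ}} ∩ {c₃ ≤ c₁ + Lc₁^{1-θ}}`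
is forward invariant under Hamilton's ODE `M' = M² + M#` relative to `Z₄ = pcoPinchingFour m G H J δ K ε`
("Consequently the set `f ≥ 1` is preserved … A similar argument works for the inequality in `c`.
This completes the proof of Theorem 7.1", p. 174). [cite: Hamilton1986, §7, Thm. 7.1 (5), Lemma 7.8 (pp. 170, 173–174)] -/
theorem hamilton1986_pinchingFive_ode {m G H J δ K ε θ L : ℝ} (hm : 0 < m) (hK : 0 < K) (hε : 0 < ε)
    (hθε : θ * (2 + ε) = 2 * ε) (hθ1 : θ ≤ 1) (hθH : 6 * H * θ ≤ 1) (hL : 2 * K ^ (1 - θ / 2) ≤ L) :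
    IsInvariantRel field (fun _ ↦ pcoPinchingFour m G H J δ K ε)
      (fun _ ↦ {p | LargestLESmallestAddPow p.1 L θ ∧ LargestLESmallestAddPow p.2.2 L θ}) :=
  ((isInvariantRel_pcoFive_fst hm hK hε hθε hθ1 hθH hL).inter
    (isInvariantRel_pcoFive_snd hm hK hε hθε hθ1 hθH hL)).mono_left
    fun _ _ ↦ pcoPinchingFour_subset

/-! ### Hamilton's pinching set: all five groups together -/

/-- **Hamilton's pinching set `Z` of Thm. 7.1** in the tree's variational language, on `{M ≥ m}`:
`Z = {A, C symmetric} ∩ {tr A = tr C} ∩ {M ≥ m} ∩ {(1)} ∩ {(2)} ∩ {(3)} ∩ {(4)} ∩ {(5)}` with the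
constants `G, H, δ, J, ε, K, θ, L`. [cite: Hamilton1986, §7, Thm. 7.1 (p. 170)] -/
def pcoPinchingFive (m G H J δ K ε L θ : ℝ) : Set Blocks :=
  pcoPinchingFour m G H J δ K ε ∩ {p | LargestLESmallestAddPow p.1 L θ ∧ LargestLESmallestAddPow p.2.2 L θ}

/-- **`Z` is forward invariant under Hamilton's ODE** ("All that remains to be shown is that `Z`
is invariant under the flow of the ODE. We shall show in fact that the sets defined by each
successive group of inequalities is preserved", p. 171), for the successively chosen constants:
`0 < m`; `0 < G`; `G + 1 ≤ H`; `0 < δ ≤ 1`, `8Hδ ≤ 1`, `4GHδ² ≤ 1`; `0 < J`; `0 < η ≤ ½`,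
`16 · 8^δ J η^δ ≤ 1`, `0 < ε`, `12ε ≤ δη`, `144ε ≤ η²`; `0 < K`; `θ(2 + ε) = 2ε`, `θ ≤ 1`, `6Hθ ≤ 1`;
`2K^{1-θ/2} ≤ L`. [cite: Hamilton1986, §7, Thm. 7.1 (pp. 170–174)] -/
theorem isInvariant_pcoPinchingFive {m G H J δ η K ε θ L : ℝ} (hm : 0 < m) (hG : 0 < G) (hH : G + 1 ≤ H)
    (hJ : 0 < J) (hδ : 0 < δ) (hδ1 : δ ≤ 1) (hδH : 8 * H * δ ≤ 1) (hδGH : 4 * G * H * δ ^ 2 ≤ 1)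
    (hη : 0 < η) (hη2 : η ≤ 1 / 2) (hηJ : 16 * 8 ^ δ * J * η ^ δ ≤ 1) (hK : 0 < K)
    (hε : 0 < ε) (hε1 : 12 * ε ≤ δ * η) (hε2 : 144 * ε ≤ η ^ 2)
    (hθε : θ * (2 + ε) = 2 * ε) (hθ1 : θ ≤ 1) (hθH : 6 * H * θ ≤ 1) (hL : 2 * K ^ (1 - θ / 2) ≤ L) :
    IsInvariant field (fun _ ↦ pcoPinchingFive m G H J δ K ε L θ) :=
  (isInvariant_pcoPinchingFour hm hG hH hJ hδ hδ1 hδH hδGH hη hη2 hηJ hK hε hε1 hε2).inter_rel_self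
    (hamilton1986_pinchingFive_ode hm hK hε hθε hθ1 hθH hL)

/-- The set (5) (block `A`) is closed for `θ ≤ 1`. [folklore] -/
theorem isClosed_largestLESmallestAddPow_fst (L : ℝ) {θ : ℝ} (hθ : θ ≤ 1) :
    IsClosed {p : Blocks | LargestLESmallestAddPow p.1 L θ} := by
  have e : {p : Blocks | LargestLESmallestAddPow p.1 L θ} =
      ⋂ q ∈ (unitSet ×ˢ unitSet : Set UU), {p | 0 ≤ pcoFiveG L θ p.1 q} := by
    ext p; simp only [mem_setOf_eq, largestLESmallestAddPow_iff, mem_iInter]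
  rw [e]
  exact isClosed_biInter fun q _ ↦ isClosed_le continuous_const
    ((continuous_pcoFiveG L θ hθ).comp (continuous_fst.prodMk continuous_const))

/-- The set (5) (block `C`) is closed for `θ ≤ 1`. [folklore] -/
theorem isClosed_largestLESmallestAddPow_snd (L : ℝ) {θ : ℝ} (hθ : θ ≤ 1) :
    IsClosed {p : Blocks | LargestLESmallestAddPow p.2.2 L θ} := by
  have e : {p : Blocks | LargestLESmallestAddPow p.2.2 L θ} =
      ⋂ q ∈ (unitSet ×ˢ unitSet : Set UU), {p | 0 ≤ pcoFiveG L θ p.2.2 q} := by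
    ext p; simp only [mem_setOf_eq, largestLESmallestAddPow_iff, mem_iInter]
  rw [e]
  exact isClosed_biInter fun q _ ↦ isClosed_le continuous_const
    ((continuous_pcoFiveG L θ hθ).comp ((continuous_snd.comp continuous_snd).prodMk continuous_const))

/-- `Z` is closed ("Clearly `Z` is closed", p. 170), for `0 ≤ δ`, `0 ≤ ε`, `θ ≤ 1`. [cite: Hamilton1986, §7, Thm. 7.1 (p. 170)] -/
theorem isClosed_pcoPinchingFive (m G H J K L : ℝ) {δ ε θ : ℝ} (hδ : 0 ≤ δ) (hε : 0 ≤ ε) (hθ : θ ≤ 1) :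
    IsClosed (pcoPinchingFive m G H J δ K ε L θ) :=
  (isClosed_pcoPinchingFour m G H J K hδ hε).inter
    ((isClosed_largestLESmallestAddPow_fst L hθ).inter (isClosed_largestLESmallestAddPow_snd L hθ))

/-- `Z` is symmetric under `B ↦ -B` ((5) does not involve `B`). [folklore] -/
theorem reflectB_mem_pcoPinchingFive {m G H J δ K ε L θ : ℝ} {p : Blocks}
    (h : p ∈ pcoPinchingFive m G H J δ K ε L θ) : reflectB p ∈ pcoPinchingFive m G H J δ K ε L θ :=
  ⟨reflectB_mem_pcoPinchingFour h.1, h.2⟩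

/-- **(5) is convex on `{a₁ ≥ 0}`**, chord form (`a₃` convex, `a₁` concave, and `t ↦ t + Lt^{1-θ}`
concave and increasing on `t ≥ 0` for `L ≥ 0`, `0 ≤ θ ≤ 1`; `Real.concaveOn_rpow`).
[cite: Hamilton1986, §7, Thm. 7.1 (p. 170); §6, p. 167 and Lemma 6.3 (p. 170)] -/
theorem LargestLESmallestAddPow.combo {X Y : Matrix (Fin 3) (Fin 3) ℝ} {L θ a b : ℝ} (hL : 0 ≤ L)
    (hθ0 : 0 ≤ θ) (hθ1 : θ ≤ 1) (hX0 : ∀ w : Fin 3 → ℝ, w ⬝ᵥ w = 1 → 0 ≤ w ⬝ᵥ (X *ᵥ w))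
    (hY0 : ∀ w : Fin 3 → ℝ, w ⬝ᵥ w = 1 → 0 ≤ w ⬝ᵥ (Y *ᵥ w))
    (hx : LargestLESmallestAddPow X L θ) (hy : LargestLESmallestAddPow Y L θ) (ha : 0 ≤ a)
    (hb : 0 ≤ b) (hab : a + b = 1) : LargestLESmallestAddPow (a • X + b • Y) L θ := by
  intro u w hu hw
  rw [quad_combo, quad_combo]
  have h₁ := hx u w hu hw
  have h₂ := hy u w hu hw
  have hc := (Real.concaveOn_rpow (by linarith : 0 ≤ 1 - θ) (by linarith)).2 (Set.mem_Ici.2 (hX0 w hw))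
    (Set.mem_Ici.2 (hY0 w hw)) ha hb hab
  simp only [smul_eq_mul] at hc
  have := mul_le_mul_of_nonneg_left hc hL
  nlinarith [mul_le_mul_of_nonneg_left h₁ ha, mul_le_mul_of_nonneg_left h₂ hb]

/-- **`Z` is convex** ("That `Z` is convex follows from Lemma 6.3", p. 170), for `m ≥ 0`,
`G, J, K, L ≥ 0`, `δ, ε > 0`, `0 ≤ θ ≤ 1`. [cite: Hamilton1986, §7, Thm. 7.1 (p. 170)] -/
theorem convex_pcoPinchingFive {m G J δ K ε L θ : ℝ} (hm : 0 ≤ m) (hG : 0 ≤ G) (hJ : 0 ≤ J)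
    (hδ : 0 < δ) (hK : 0 ≤ K) (hε : 0 < ε) (hL : 0 ≤ L) (hθ0 : 0 ≤ θ) (hθ1 : θ ≤ 1) (H : ℝ) :
    Convex ℝ (pcoPinchingFive m G H J δ K ε L θ) := by
  rintro x ⟨hx4, hx5A, hx5C⟩ y ⟨hy4, hy5A, hy5C⟩ a b ha hb hab
  have hxo : OperatorGE x m := hx4.1.1.2.2.1
  have hyo : OperatorGE y m := hy4.1.1.2.2.1
  have hX0 : ∀ w : Fin 3 → ℝ, w ⬝ᵥ w = 1 → 0 ≤ w ⬝ᵥ (x.1 *ᵥ w) := fun w hw ↦ by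
    have := hxo.quad_fst w; rw [hw, mul_one] at this; linarith
  have hY0 : ∀ w : Fin 3 → ℝ, w ⬝ᵥ w = 1 → 0 ≤ w ⬝ᵥ (y.1 *ᵥ w) := fun w hw ↦ by
    have := hyo.quad_fst w; rw [hw, mul_one] at this; linarith
  have hX0' : ∀ w : Fin 3 → ℝ, w ⬝ᵥ w = 1 → 0 ≤ w ⬝ᵥ (x.2.2 *ᵥ w) := fun w hw ↦ by
    have := hxo.quad_snd_snd w; rw [hw, mul_one] at this; linarith
  have hY0' : ∀ w : Fin 3 → ℝ, w ⬝ᵥ w = 1 → 0 ≤ w ⬝ᵥ (y.2.2 *ᵥ w) := fun w hw ↦ by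
    have := hyo.quad_snd_snd w; rw [hw, mul_one] at this; linarith
  refine ⟨convex_pcoPinchingFour hm hG hJ hδ hK hε H hx4 hy4 ha hb hab, ?_, ?_⟩
  · simpa only [combo_fst] using LargestLESmallestAddPow.combo hL hθ0 hθ1 hX0 hY0 hx5A hy5A ha hb hab
  · simpa only [combo_snd_snd] using LargestLESmallestAddPow.combo hL hθ0 hθ1 hX0' hY0' hx5C hy5C ha hb hab

end HamiltonODE

end Literature.Geometry.Riemannian

end
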